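import Literature.NumberTheory.LFunctions.DeBruijnHSimpleZeros
import Literature.NumberTheory.LFunctions.DeBruijnNewmanConstProofs
import Literature.Analysis.Complex.Hurwitz
import Mathlib.Analysis.SpecialFunctions.Gaussian.FourierTransform
import Mathlib.RingTheory.Polynomial.Vieta
import Mathlib.Analysis.Complex.Polynomial.Basic
import HarnessLib

/-!
# Csordas–Smith–Varga: the zeros of `H_t` are simple for `t > Λ` — the discharge

Trunk T-ANT (`Literature/NumberTheory/LFunctions`). Proofs only (no definitions, no named facts;
`gaussMoment`, `heatPoly`, `rescaledIntegrand` below are local notations), companion of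
`DeBruijnHSimpleZeros.lean`, whose single named fact

> `Literature.NumberTheory.LFunctions.csordasSmithVarga_simple_zeros` (Csordas–Smith–Varga 1994, **Thm. 2.2**, as printed in
> Andrade–Chang–Miller 2014, Lemma 1.5: "If `H_{t₀}(x)` has a zero `x₀` of order at least `2`,
> then `t₀ ≤ Λ`"; `sInf`-free: if `t₁ < t₀` and `H_{t₁}` has only real zeros, every real zero of
> `H_{t₀}` is simple)

is **proved** here (`Literature.NumberTheory.LFunctions.csordasSmithVarga_simple_zeros_holds`), for de Bruijn's family
`H_t(z) = ∫₀^∞ e^{tu²} Φ(u) cos(zu) du` (`Literature.NumberTheory.LFunctions.deBruijnH`). With `RodgersTaoZerosProofs.lean` this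
removes the Csordas–Smith–Varga input from the leaves of the Rodgers–Tao decomposition of
`Literature.NumberTheory.LFunctions.rodgers_tao` (`RodgersTao.lean`, `RodgersTaoEnergy.lean`): the assembly there then rests on
Rodgers–Tao's Thm. 7.2 and Prop. 8.2, the Riemann–von Mangoldt formula and the Selberg–Fujii
small-gap theorem alone. This file is independent of the Rodgers–Tao files.

## The argument (the backward heat flow near a multiple zero; cf. Andrade–Chang–Miller 2014,
Remark 1.6: "if `Ξ_{t₀}` has a double zero, these zeros are likely to 'pop off' the real line as
we further decrease `t`")

* **Gaussian smoothing** (`deBruijnH_sub_sq_eq_integral`; Rodgers–Tao 2020, §2, eq. (15)):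
  `H_{t₀ − σ²}(z) = (4π)^{-1/2} ∫_ℝ e^{−r²/4} H_{t₀}(z + σ r) dr` for all real `t₀, σ` and complex
  `z` — from `e^{−σ²u²} = (4π)^{-1/2} ∫ e^{−r²/4} e^{iσur} dr` (Mathlib's `integral_cexp_quadratic`),
  the trigonometric-integral form `∫ F_{t₀}(u) e^{izu} du = 2H_{t₀}(z)` of
  `DeBruijnNewmanConstProofs.lean`, and Fubini.
* **Local structure** (`exists_factor_of_multiple_zero`): at a real zero `x₀` with
  `H_{t₀}'(x₀) = 0`, `H_{t₀}(x₀ + ζ) = ζ^m g(ζ)` with `m ≥ 2`, `g` continuous, `g(0) ≠ 0`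
  (`H_{t₀}` is entire and `H_{t₀}(0) ≠ 0`); `g` is bounded on horizontal strips
  (`exists_bound_factor`, from the strip bound `deBruijnHBound` of `DeBruijnNewmanProofs.lean`).
* **Rescaling**: `σ^{−m} H_{t₀−σ²}(x₀ + σw) = (4π)^{-1/2} ∫ e^{−r²/4} (w + r)^m g(σ(w + r)) dr`
  converges, uniformly for `w` in compact sets as `σ → 0`, to `(4π)^{-1/2} g(0) P_m(w)` with the
  heat polynomial `P_m(w) = ∫ e^{−r²/4} (w + r)^m dr = Σ_k C(m,k) M_{m−k} w^k`,
  `M_j = ∫ e^{−r²/4} r^j dr` (dominated convergence gives joint continuity in `(σ, w)`, and a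
  continuous function on the compact `[−1,1] × B̄(0,R)` is uniformly continuous).
* **`P_m` has a non-real root** for `m ≥ 2` (`exists_root_heatPoly_im_ne_zero`): `M_0 > 0`,
  `M_1 = 0`, `M_2 > 0`, so by Vieta a real-rooted `P_m` would have `Σ roots = 0` and
  `Σ roots² = −2 e₂ = −2 C(m,2) M_2/M_0 < 0`, absurd.
* **Hurwitz** (`Complex.eventually_exists_zero_mem_ball_of_tendstoUniformlyOn`,
  `Literature/Analysis/Complex/Hurwitz.lean`): for all small `σ > 0`, `H_{t₀−σ²}` has a zero
  `x₀ + σw` with `w` near a non-real root of `P_m`, hence a non-real zero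
  (`eventually_exists_nonreal_zero`); but if `H_{t₁}` (`t₁ < t₀`) had only real zeros, de Bruijn's
  monotonicity (`mono_deBruijnH_holds`) would make `H_{t₀−σ²}` real-rooted for `σ² < t₀ − t₁`.

## Main results

* `Literature.NumberTheory.LFunctions.deBruijnH_sub_sq_eq_integral` — the Gaussian smoothing identity.
* `Literature.NumberTheory.LFunctions.eventually_exists_nonreal_zero` — non-real zeros of `H_{t₀−σ²}` near a multiple real zero
  of `H_{t₀}`, for all small `σ > 0`.
* `Literature.NumberTheory.LFunctions.csordasSmithVarga_simple_zeros_holds` — **discharge of `Literature.NumberTheory.LFunctions.csordasSmithVarga_simple_zeros`**.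

## References

* G. Csordas, W. Smith, R. S. Varga, *Lehmer pairs of zeros, the de Bruijn–Newman constant `Λ`,
  and the Riemann Hypothesis*, Constr. Approx. 10 (1994), 107–129, Thm. 2.2.
* J. Andrade, A. Chang, S. J. Miller, *Newman's conjecture in various settings*, J. Number Theory
  144 (2014), 70–91 = arXiv:1310.3477, Lemma 1.5, Remark 1.6.
* B. Rodgers, T. Tao, *The de Bruijn–Newman constant is non-negative*, Forum Math. Pi 8 (2020),
  e6 = arXiv:1801.05914, §1.2, §2 eq. (15).
* J. B. Conway, *Functions of One Complex Variable I*, 2nd ed., Ch. VII, Thm. 2.5 (Hurwitz).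
-/

noncomputable section

open Complex Filter Set Topology MeasureTheory Polynomial Metric

namespace Literature.NumberTheory.LFunctions

/-! ## Part A: Gaussian smoothing identity `H_{t₀−s}(z) = (4π)^{-1/2} ∫ e^{−r²/4} H_{t₀}(z + r√s) dr` -/

/-- The Gaussian Fourier integral `∫ e^{−r²/4} e^{i a r} dr = (4π)^{1/2} e^{−a²}` (complex `a`;
Mathlib's `integral_cexp_quadratic`). [folklore] -/
theorem integral_gaussian_quarter_cexp (a : ℂ) :
    ∫ r : ℝ, cexp (-(r : ℂ) ^ 2 / 4) * cexp (I * a * r) =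
      ((4 * Real.pi : ℝ) : ℂ) ^ (1 / 2 : ℂ) * cexp (-a ^ 2) := by
  have hb : (-(1 / 4 : ℂ)).re < 0 := by norm_num
  have h := integral_cexp_quadratic hb (I * a) 0
  have e1 : (fun x : ℝ ↦ cexp (-(1 / 4 : ℂ) * x ^ 2 + I * a * x + 0)) =
      fun r : ℝ ↦ cexp (-(r : ℂ) ^ 2 / 4) * cexp (I * a * r) := by
    funext r
    rw [← Complex.exp_add]
    congr 1
    ring
  rw [e1] at h
  rw [h]
  congr 1
  · congr 1
    push_cast
    ring
  · congr 1
    field_simp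
    rw [Complex.I_sq]
    ring

/-- The de Bruijn kernel at time `t₀ − s` is the kernel at time `t₀` damped by `e^{−s u²}`.
[folklore] -/
theorem deBruijnKernel_sub (t₀ s u : ℝ) :
    deBruijnKernel (t₀ - s) u = deBruijnKernel t₀ u * cexp (-(s : ℂ) * u ^ 2) := by
  simp only [deBruijnKernel]
  push_cast
  rw [show ((t₀ : ℂ) - s) * (u : ℂ) ^ 2 = t₀ * u ^ 2 + -(s : ℂ) * u ^ 2 by ring, Complex.exp_add]
  ring


/-- The constant `(4π)^{1/2}` (as a complex power) is non-zero. [folklore] -/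
theorem four_pi_cpow_half_ne_zero : ((4 * Real.pi : ℝ) : ℂ) ^ (1 / 2 : ℂ) ≠ 0 := by
  rw [Ne, Complex.cpow_eq_zero_iff, not_and_or]
  left
  exact_mod_cast (by positivity : (4 * Real.pi : ℝ) ≠ 0)

/-- **Gaussian smoothing (backward heat flow).** For real `t₀`, `σ` and complex `z`,
`H_{t₀ − σ²}(z) = (4π)^{-1/2} ∫_ℝ e^{−r²/4} H_{t₀}(z + σ r) dr` (the heat-kernel identity
`e^{tu²} e^{izu} = (4π)^{-1/2} ∫ e^{−r²/4} e^{i(z + r|t|^{1/2})u} dr` of Rodgers–Tao 2020, §2 (15),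
integrated against `Φ`). [cite: RodgersTaoFMP2020, §2 eq. (15)] -/
theorem deBruijnH_sub_sq_eq_integral (t₀ σ : ℝ) (z : ℂ) :
    deBruijnH (t₀ - σ ^ 2) z = (((4 * Real.pi : ℝ) : ℂ) ^ (1 / 2 : ℂ))⁻¹ *
      ∫ r : ℝ, cexp (-(r : ℂ) ^ 2 / 4) * deBruijnH t₀ (z + σ * r) := by
  set C : ℂ := ((4 * Real.pi : ℝ) : ℂ) ^ (1 / 2 : ℂ) with hC
  have hC0 : C ≠ 0 := four_pi_cpow_half_ne_zero
  set K : ℝ → ℂ := deBruijnKernel t₀ with hK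
  have hKadm : Literature.Analysis.Complex.DeBruijn1950.IsAdmissible K := isAdmissible_deBruijnKernel t₀
  -- the two-variable integrand and its integrability
  set G : ℝ → ℝ → ℂ := fun r u ↦ cexp (-(r : ℂ) ^ 2 / 4) * (K u * cexp (I * (z + σ * r) * u))
    with hG
  have hGi : Integrable (Function.uncurry G) (volume.prod volume) := by
    have hf : Integrable fun r : ℝ ↦ Real.exp (-(1 / 4) * r ^ 2) :=
      integrable_exp_neg_mul_sq (by norm_num)
    have hg : Integrable fun u : ℝ ↦ ‖K u‖ * Real.exp (‖z‖ * |u|) := hKadm.integrable_norm_mul_exp _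
    refine (hf.mul_prod hg).mono' ?_ (Eventually.of_forall fun p ↦ ?_)
    · have hc : Continuous (Function.uncurry G) := by
        simp only [hG, Function.uncurry_def]
        have := continuous_deBruijnKernel t₀
        fun_prop
      exact hc.aestronglyMeasurable
    · obtain ⟨r, u⟩ := p
      simp only [Function.uncurry_apply_pair, hG, norm_mul]
      have h1 : ‖cexp (-(r : ℂ) ^ 2 / 4)‖ = Real.exp (-(1 / 4) * r ^ 2) := by
        rw [Complex.norm_exp]
        congr 1
        rw [show -(r : ℂ) ^ 2 / 4 = ((-(1 / 4) * r ^ 2 : ℝ) : ℂ) by push_cast; ring, Complex.ofReal_re]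
      have h2 : ‖cexp (I * (z + σ * r) * u)‖ ≤ Real.exp (‖z‖ * |u|) := by
        have : cexp (I * (z + σ * r) * u) = cexp (I * z * u) * cexp (I * ((σ * r * u : ℝ) : ℂ)) := by
          rw [← Complex.exp_add]; push_cast; ring_nf
        rw [this, norm_mul, Complex.norm_exp_I_mul_ofReal, mul_one]
        exact Literature.Analysis.Complex.norm_cexp_I_mul_mul_le z u
      rw [h1]
      gcongr
  -- Fubini
  have hswap := integral_integral_swap hGi
  -- the inner `r`-integral: Fourier transform of the Gaussian
  have hinner : ∀ u : ℝ, ∫ r : ℝ, G r u = C * (K u * cexp (-(σ : ℂ) ^ 2 * u ^ 2) * cexp (I * z * u)) := by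
    intro u
    have e : (fun r : ℝ ↦ G r u) =
        fun r : ℝ ↦ (K u * cexp (I * z * u)) * (cexp (-(r : ℂ) ^ 2 / 4) * cexp (I * (σ * u : ℂ) * r)) := by
      funext r
      simp only [hG]
      rw [show I * (z + σ * r) * u = I * z * u + I * (σ * u : ℂ) * r by ring, Complex.exp_add]
      ring
    rw [e, integral_const_mul, integral_gaussian_quarter_cexp]
    rw [show -((σ : ℂ) * u) ^ 2 = -(σ : ℂ) ^ 2 * u ^ 2 by ring]
    ring
  -- the inner `u`-integral: `2 H_{t₀}(z + σ r)`
  have hinner' : ∀ r : ℝ, ∫ u : ℝ, G r u = cexp (-(r : ℂ) ^ 2 / 4) * (2 * deBruijnH t₀ (z + σ * r)) := by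
    intro r
    simp only [hG]
    rw [integral_const_mul, ← trigIntegral_deBruijnKernel]
    rfl
  -- assemble
  have hlhs : 2 * deBruijnH (t₀ - σ ^ 2) z = C⁻¹ * ∫ u : ℝ, ∫ r : ℝ, G r u := by
    rw [← trigIntegral_deBruijnKernel, Literature.Analysis.Complex.trigIntegral]
    simp_rw [hinner]
    rw [integral_const_mul, ← mul_assoc, inv_mul_cancel₀ hC0, one_mul]
    congr 1
    funext u
    rw [show t₀ - σ ^ 2 = t₀ - σ ^ 2 from rfl, deBruijnKernel_sub]
    push_cast
    ring
  have hrhs : ∫ r : ℝ, ∫ u : ℝ, G r u = 2 * ∫ r : ℝ, cexp (-(r : ℂ) ^ 2 / 4) * deBruijnH t₀ (z + σ * r) := by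
    simp_rw [hinner']
    rw [← integral_const_mul]
    congr 1
    funext r
    ring
  have : 2 * deBruijnH (t₀ - σ ^ 2) z =
      2 * (C⁻¹ * ∫ r : ℝ, cexp (-(r : ℂ) ^ 2 / 4) * deBruijnH t₀ (z + σ * r)) := by
    rw [hlhs, ← hswap, hrhs]
    ring
  exact mul_left_cancel₀ two_ne_zero this


/-! ## Gaussian moments and the heat polynomials -/

/-- `‖e^{−r²/4}‖ = e^{−r²/4}` for real `r`. [folklore] -/
theorem norm_cexp_neg_sq_quarter (r : ℝ) : ‖cexp (-(r : ℂ) ^ 2 / 4)‖ = Real.exp (-(1 / 4) * r ^ 2) := by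
  rw [Complex.norm_exp]
  congr 1
  rw [show -(r : ℂ) ^ 2 / 4 = ((-(1 / 4) * r ^ 2 : ℝ) : ℂ) by push_cast; ring, Complex.ofReal_re]

/-- `e^{−r²/4}` as the coercion of a real exponential. [folklore] -/
theorem cexp_neg_sq_quarter_eq (r : ℝ) :
    cexp (-(r : ℂ) ^ 2 / 4) = (Real.exp (-(1 / 4) * r ^ 2) : ℂ) := by
  rw [Complex.ofReal_exp]
  congr 1
  push_cast
  ring

/-- Local notation (not a declaration): the Gaussian moments `M_j = ∫ e^{−r²/4} r^j dr`
(complex-valued), written `gaussMoment j`. -/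
local notation3 "gaussMoment " j:max => ∫ r : ℝ, cexp (-(r : ℂ) ^ 2 / 4) * (r : ℂ) ^ (j : ℕ)

/-- `e^{−r²/4} |r|^p` is integrable for real `p ≥ 0`. [folklore] -/
theorem integrable_abs_rpow_mul_exp_neg_sq_quarter {p : ℝ} (hp : 0 ≤ p) :
    Integrable fun r : ℝ ↦ |r| ^ p * Real.exp (-(1 / 4) * r ^ 2) := by
  set F : ℝ → ℝ := fun r ↦ |r| ^ p * Real.exp (-(1 / 4) * r ^ 2) with hF
  have hIoi : IntegrableOn F (Ioi 0) :=
    (integrableOn_rpow_mul_exp_neg_mul_sq (b := 1 / 4) (by norm_num) (s := p) (by linarith)).congr_fun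
      (fun r (hr : 0 < r) ↦ by simp [hF, abs_of_pos hr]) measurableSet_Ioi
  have hIic : IntegrableOn F (Iic 0) := by
    rw [← Measure.map_neg_eq_self (volume : Measure ℝ)]
    let m : MeasurableEmbedding fun x : ℝ ↦ -x := (Homeomorph.neg ℝ).measurableEmbedding
    rw [m.integrableOn_map_iff]
    simp_rw [Function.comp_def, hF, abs_neg, neg_sq, neg_preimage, neg_Iic, neg_zero]
    exact (integrableOn_Ici_iff_integrableOn_Ioi (by finiteness)).2 hIoi
  have := hIic.union hIoi
  rwa [Iic_union_Ioi, integrableOn_univ] at this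

/-- `e^{−r²/4} r^j` is integrable (complex form). [folklore] -/
theorem integrable_gaussMoment (j : ℕ) :
    Integrable fun r : ℝ ↦ cexp (-(r : ℂ) ^ 2 / 4) * (r : ℂ) ^ j := by
  refine (integrable_abs_rpow_mul_exp_neg_sq_quarter (Nat.cast_nonneg j)).mono' (by fun_prop)
    (Eventually.of_forall fun r ↦ ?_)
  rw [norm_mul, norm_cexp_neg_sq_quarter, norm_pow, Complex.norm_real, Real.norm_eq_abs,
    Real.rpow_natCast, mul_comm]

/-- `M_0 = (4π)^{1/2}`. [folklore] -/
theorem gaussMoment_zero : gaussMoment 0 = ((4 * Real.pi : ℝ) : ℂ) ^ (1 / 2 : ℂ) := by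
  have h := integral_gaussian_quarter_cexp 0
  simp only [mul_zero, zero_mul, Complex.exp_zero, mul_one, ne_eq, OfNat.ofNat_ne_zero,
    not_false_eq_true, zero_pow, neg_zero] at h
  simpa using h

/-- `(4π)^{1/2}` is the real number `√(4π) > 0`. [folklore] -/
theorem four_pi_cpow_half_eq : ((4 * Real.pi : ℝ) : ℂ) ^ (1 / 2 : ℂ) = ((Real.sqrt (4 * Real.pi) : ℝ) : ℂ) := by
  rw [Real.sqrt_eq_rpow, Complex.ofReal_cpow (by positivity)]
  norm_num

/-- `M_1 = 0` (odd integrand). [folklore] -/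
theorem gaussMoment_one : gaussMoment 1 = 0 := by
  have h := integral_neg_eq_self (fun r : ℝ ↦ cexp (-(r : ℂ) ^ 2 / 4) * (r : ℂ) ^ 1) volume
  have e : (fun r : ℝ ↦ cexp (-((-r : ℝ) : ℂ) ^ 2 / 4) * ((-r : ℝ) : ℂ) ^ 1) =
      fun r : ℝ ↦ -(cexp (-(r : ℂ) ^ 2 / 4) * (r : ℂ) ^ 1) := by
    funext r; push_cast; ring
  rw [e, integral_neg] at h
  have : (2 : ℂ) * ∫ r : ℝ, cexp (-(r : ℂ) ^ 2 / 4) * (r : ℂ) ^ 1 = 0 := by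
    linear_combination -h
  simpa using this

/-- `M_2` is real and positive. [folklore] -/
theorem gaussMoment_two : gaussMoment 2 = ((∫ r : ℝ, r ^ 2 * Real.exp (-(1 / 4) * r ^ 2) : ℝ) : ℂ) ∧
    0 < ∫ r : ℝ, r ^ 2 * Real.exp (-(1 / 4) * r ^ 2) := by
  constructor
  · rw [← integral_complex_ofReal]
    congr 1
    funext r
    rw [cexp_neg_sq_quarter_eq]
    push_cast
    ring
  · have hint : Integrable fun r : ℝ ↦ r ^ 2 * Real.exp (-(1 / 4) * r ^ 2) := by
      have := integrable_abs_rpow_mul_exp_neg_sq_quarter (p := 2) (by norm_num)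
      refine this.congr (Eventually.of_forall fun r ↦ ?_)
      simp only
      rw [show (2 : ℝ) = ((2 : ℕ) : ℝ) by norm_num, Real.rpow_natCast, sq_abs]
    refine (integral_pos_iff_support_of_nonneg (fun r ↦ by positivity) hint).2 ?_
    have hsupp : Function.support (fun r : ℝ ↦ r ^ 2 * Real.exp (-(1 / 4) * r ^ 2)) = {0}ᶜ := by
      ext r
      simp [Real.exp_ne_zero]
    rw [hsupp]
    have : volume ({0}ᶜ : Set ℝ) = ⊤ := by
      rw [measure_compl (measurableSet_singleton 0) (by simp), Real.volume_univ, measure_singleton]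
      simp
    rw [this]
    exact ENNReal.zero_lt_top

/-! ## Part D: a complex polynomial with `e₁ = 0`, `e₂ > 0` pattern has a non-real root -/

/-- Newton's identity in degree two for multisets: `(Σ s)² = Σ s² + 2 e₂(s)`. [folklore] -/
theorem Multiset.sum_sq_eq_sum_map_sq_add {R : Type*} [CommRing R] (s : Multiset R) :
    s.sum ^ 2 = (s.map (· ^ 2)).sum + 2 * s.esymm 2 := by
  induction s using Multiset.induction_on with
  | empty => simp [Multiset.esymm]
  | cons a s ih =>
    have h1 : (a ::ₘ s).esymm 2 = s.esymm 2 + a * s.esymm 1 := by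
      simp only [Multiset.esymm, Multiset.powersetCard_cons, Multiset.map_add, Multiset.sum_add,
        Multiset.map_map, Function.comp_def, Multiset.prod_cons]
      rw [Multiset.sum_map_mul_left]
    have h2 : s.esymm 1 = s.sum := by
      simp [Multiset.esymm, Multiset.powersetCard_one, Multiset.map_map]
    rw [h1, h2, Multiset.sum_cons, Multiset.map_cons, Multiset.sum_cons]
    linear_combination ih

/-- For a multiset of real complex numbers, `Re Σ s² ≥ 0`. [folklore] -/
theorem sum_map_sq_re_nonneg (s : Multiset ℂ) (h : ∀ w ∈ s, w.im = 0) :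
    0 ≤ ((s.map (· ^ 2)).sum).re := by
  induction s using Multiset.induction_on with
  | empty => simp
  | cons a s ih =>
    rw [Multiset.map_cons, Multiset.sum_cons, Complex.add_re]
    have ha : a.im = 0 := h a (Multiset.mem_cons_self a s)
    have h1 : 0 ≤ (a ^ 2).re := by
      rw [sq, Complex.mul_re, ha, mul_zero, sub_zero]
      exact mul_self_nonneg _
    exact add_nonneg h1 (ih fun w hw ↦ h w (Multiset.mem_cons_of_mem hw))

/-- If a complex polynomial of degree `n ≥ 2` has vanishing coefficient of `X^{n−1}` and
`Re (a_{n−2}/a_n) > 0`, then it has a non-real root: were all roots real, Vieta would give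
`Σ roots = 0` and `e₂(roots) = a_{n−2}/a_n`, whence `Σ roots² = −2 e₂ < 0`. [folklore] -/
theorem exists_root_im_ne_zero {p : ℂ[X]} {n : ℕ} (hn : p.natDegree = n) (h2 : 2 ≤ n)
    (hlead : p.leadingCoeff ≠ 0) (h1 : p.coeff (n - 1) = 0)
    (hpos : 0 < (p.coeff (n - 2) / p.leadingCoeff).re) :
    ∃ w : ℂ, p.IsRoot w ∧ w.im ≠ 0 := by
  have hp0 : p ≠ 0 := leadingCoeff_ne_zero.1 hlead
  have hsplit : p.Splits := IsAlgClosed.splits p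
  have hcard : Multiset.card p.roots = p.natDegree := splits_iff_card_roots.1 hsplit
  -- Vieta for the two top coefficients
  have hv1 := Polynomial.coeff_eq_esymm_roots_of_splits hsplit (k := n - 1) (by omega)
  have hv2 := Polynomial.coeff_eq_esymm_roots_of_splits hsplit (k := n - 2) (by omega)
  rw [hn, show n - (n - 1) = 1 by omega, pow_one] at hv1
  rw [hn, show n - (n - 2) = 2 by omega] at hv2
  have he1 : p.roots.esymm 1 = p.roots.sum := by
    simp [Multiset.esymm, Multiset.powersetCard_one, Multiset.map_map]
  have hsum : p.roots.sum = 0 := by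
    rw [h1] at hv1
    have : p.leadingCoeff * p.roots.esymm 1 = 0 := by
      have := hv1.symm
      rw [mul_assoc, mul_comm ((-1 : ℂ)) _, ← mul_assoc, mul_neg_one, neg_eq_zero] at this
      exact this
    rw [← he1]
    exact (mul_eq_zero.1 this).resolve_left hlead
  have he2 : p.roots.esymm 2 = p.coeff (n - 2) / p.leadingCoeff := by
    rw [hv2]
    field_simp
  -- Newton: Σ roots² = −2 e₂
  have hnewton := Multiset.sum_sq_eq_sum_map_sq_add p.roots
  rw [hsum, he2] at hnewton
  -- if all roots were real, Σ roots² would have non-negative real part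
  by_contra hall
  push Not at hall
  have hreal : ∀ w ∈ p.roots, w.im = 0 := fun w hw ↦ hall w ((mem_roots hp0).1 hw)
  have hre : 0 ≤ ((p.roots.map (· ^ 2)).sum).re := sum_map_sq_re_nonneg p.roots hreal
  have : ((p.roots.map (· ^ 2)).sum).re = -2 * (p.coeff (n - 2) / p.leadingCoeff).re := by
    have := congrArg Complex.re hnewton
    simp at this
    linarith
  linarith


/-! ## The heat polynomials `P_m(w) = ∫ e^{−r²/4} (w + r)^m dr` -/

/-- Local notation (not a declaration): the heat polynomial
`P_m = Σ_k C(m,k) M_{m−k} X^k ∈ ℂ[X]` (so that `P_m(w) = ∫ e^{−r²/4} (w + r)^m dr`), written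
`heatPoly m`. -/
local notation3 "heatPoly " m:max =>
  ∑ k ∈ Finset.range ((m : ℕ) + 1),
    Polynomial.C (((m : ℕ).choose k : ℂ) * gaussMoment ((m : ℕ) - k)) * Polynomial.X ^ k

/-- Local notation (not a declaration): the two-parameter integrand
`e^{−r²/4} (w + r)^m g(σ(w + r))` at `p = (σ, w)`, written `rescaledIntegrand g m p r`. -/
local notation3 "rescaledIntegrand " g:max m:max p:max r:max =>
  cexp (-(r : ℂ) ^ 2 / 4) *
    (((p : ℝ × ℂ).2 + (r : ℂ)) ^ (m : ℕ) * (g : ℂ → ℂ) ((p : ℝ × ℂ).1 * ((p : ℝ × ℂ).2 + (r : ℂ))))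

/-- `P_m(w) = ∫ e^{−r²/4} (w + r)^m dr`. [folklore] -/
theorem eval_heatPoly (m : ℕ) (w : ℂ) :
    (heatPoly m).eval w = ∫ r : ℝ, cexp (-(r : ℂ) ^ 2 / 4) * (w + r) ^ m := by
  have hterm : ∀ k ∈ Finset.range (m + 1), Integrable fun r : ℝ ↦
      cexp (-(r : ℂ) ^ 2 / 4) * (w ^ k * (r : ℂ) ^ (m - k) * (m.choose k : ℂ)) := by
    intro k _
    have := (integrable_gaussMoment (m - k)).const_mul (w ^ k * (m.choose k : ℂ))
    refine this.congr (Eventually.of_forall fun r ↦ ?_)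
    simp only
    ring
  have hexp : (fun r : ℝ ↦ cexp (-(r : ℂ) ^ 2 / 4) * (w + r) ^ m) = fun r : ℝ ↦
      ∑ k ∈ Finset.range (m + 1), cexp (-(r : ℂ) ^ 2 / 4) * (w ^ k * (r : ℂ) ^ (m - k) * (m.choose k : ℂ)) := by
    funext r
    rw [add_pow, Finset.mul_sum]
  rw [hexp, integral_finsetSum _ hterm, eval_finsetSum]
  refine Finset.sum_congr rfl fun k _ ↦ ?_
  rw [eval_mul, eval_C, eval_pow, eval_X, ← integral_const_mul, ← integral_mul_const]
  congr 1
  funext r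
  ring

/-- The coefficients of `P_m`. [folklore] -/
theorem coeff_heatPoly (m k : ℕ) :
    (heatPoly m).coeff k = if k ≤ m then (m.choose k : ℂ) * gaussMoment (m - k) else 0 := by
  rw [finsetSum_coeff]
  simp only [coeff_C_mul, coeff_X_pow]
  split_ifs with h
  · rw [Finset.sum_eq_single k]
    · simp
    · intro j _ hj
      simp [Ne.symm hj]
    · intro hk
      simp at hk
      omega
  · refine Finset.sum_eq_zero fun j hj ↦ ?_
    simp at hj
    have : k ≠ j := by omega
    simp [this]

/-- `P_m` has degree `m` and leading coefficient `M_0 = (4π)^{1/2}`. [folklore] -/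
theorem natDegree_heatPoly (m : ℕ) : (heatPoly m).natDegree = m ∧
    (heatPoly m).leadingCoeff = ((4 * Real.pi : ℝ) : ℂ) ^ (1 / 2 : ℂ) := by
  have hle : (heatPoly m).natDegree ≤ m := by
    refine natDegree_sum_le_of_forall_le _ _ fun k hk ↦ (natDegree_C_mul_X_pow_le _ _).trans ?_
    simp at hk
    omega
  have hm : (heatPoly m).coeff m = ((4 * Real.pi : ℝ) : ℂ) ^ (1 / 2 : ℂ) := by
    rw [coeff_heatPoly, if_pos le_rfl, Nat.choose_self, Nat.sub_self, gaussMoment_zero]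
    simp
  have hne : (heatPoly m).coeff m ≠ 0 := by rw [hm]; exact four_pi_cpow_half_ne_zero
  have hdeg : (heatPoly m).natDegree = m := natDegree_eq_of_le_of_coeff_ne_zero hle hne
  exact ⟨hdeg, by rw [leadingCoeff, hdeg, hm]⟩

/-- For `m ≥ 2`, the heat polynomial `P_m` has a non-real root. [folklore] -/
theorem exists_root_heatPoly_im_ne_zero {m : ℕ} (hm : 2 ≤ m) :
    ∃ w : ℂ, (heatPoly m).IsRoot w ∧ w.im ≠ 0 := by
  obtain ⟨hdeg, hlead⟩ := natDegree_heatPoly m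
  refine exists_root_im_ne_zero hdeg hm (by rw [hlead]; exact four_pi_cpow_half_ne_zero) ?_ ?_
  · rw [coeff_heatPoly, if_pos (by omega), show m - (m - 1) = 1 by omega, gaussMoment_one, mul_zero]
  · rw [coeff_heatPoly, if_pos (by omega), show m - (m - 2) = 2 by omega, hlead,
      four_pi_cpow_half_eq, gaussMoment_two.1, Nat.choose_symm hm]
    have h2 := gaussMoment_two.2
    have hc : (0 : ℝ) < m.choose 2 := by exact_mod_cast Nat.choose_pos hm
    have hs : 0 < Real.sqrt (4 * Real.pi) := Real.sqrt_pos.2 (by positivity)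
    rw [show ((m.choose 2 : ℕ) : ℂ) = ((m.choose 2 : ℝ) : ℂ) by norm_cast, ← Complex.ofReal_mul,
      ← Complex.ofReal_div, Complex.ofReal_re]
    positivity


/-! ## Part B: local structure of `H_{t₀}` at a multiple real zero -/

/-- If `x₀` is a real zero of `H_{t₀}` with `H_{t₀}'(x₀) = 0`, then `H_{t₀}(x₀ + ζ) = ζ^m g(ζ)`
for some `m ≥ 2` and a continuous `g` with `g(0) ≠ 0` (`H_{t₀}` is entire and not identically
zero, `H_{t₀}(0) ≠ 0`). [folklore] -/
theorem exists_factor_of_multiple_zero (t₀ : ℝ) {x₀ : ℝ} (h0 : deBruijnH t₀ x₀ = 0)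
    (h1 : deriv (deBruijnH t₀) x₀ = 0) :
    ∃ (m : ℕ) (g : ℂ → ℂ), 2 ≤ m ∧ Continuous g ∧ g 0 ≠ 0 ∧
      ∀ ζ : ℂ, deBruijnH t₀ (x₀ + ζ) = ζ ^ m * g ζ := by
  classical
  set H := deBruijnH t₀ with hH
  have hd : Differentiable ℂ H := differentiable_deBruijnH_holds t₀
  have ha : AnalyticAt ℂ H x₀ := hd.analyticAt x₀
  have hne_top : analyticOrderAt H x₀ ≠ ⊤ := by
    intro htop
    have hev := analyticOrderAt_eq_top.1 htop
    have hall := (hd.differentiableOn.analyticOnNhd isOpen_univ).eqOn_zero_of_preconnected_of_eventuallyEq_zero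
      isPreconnected_univ (mem_univ (x₀ : ℂ)) hev
    exact deBruijnH_apply_zero_ne_zero t₀ (hall (mem_univ 0))
  obtain ⟨m, hm⟩ := ENat.ne_top_iff_exists.1 hne_top
  have h2m : 2 ≤ m := by
    have := (two_le_analyticOrderAt_deBruijnH_iff differentiable_deBruijnH_holds t₀ x₀).2 ⟨h0, h1⟩
    rw [← hH, ← hm] at this
    exact_mod_cast this
  obtain ⟨g₀, hg₀a, hg₀ne, hfac⟩ := ha.analyticOrderAt_eq_natCast.1 hm.symm
  let g : ℂ → ℂ := fun ζ ↦ if ζ = 0 then g₀ x₀ else H (x₀ + ζ) / ζ ^ m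
  have hg_ne : ∀ ζ : ℂ, ζ ≠ 0 → g ζ = H (x₀ + ζ) / ζ ^ m := fun ζ hζ ↦ by simp [g, hζ]
  refine ⟨m, g, h2m, ?_, by simp [g, hg₀ne], fun ζ ↦ ?_⟩
  · rw [continuous_iff_continuousAt]
    intro ζ
    by_cases hζ : ζ = 0
    · subst hζ
      have hc : ContinuousAt (fun ζ : ℂ ↦ (x₀ : ℂ) + ζ) 0 := by fun_prop
      have hc' : Tendsto (fun ζ : ℂ ↦ (x₀ : ℂ) + ζ) (𝓝 0) (𝓝 x₀) := by
        simpa using hc.tendsto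
      have hev : g =ᶠ[𝓝 0] fun ζ ↦ g₀ (x₀ + ζ) := by
        filter_upwards [hc'.eventually hfac] with ζ hζ'
        by_cases hz : ζ = 0
        · simp [g, hz]
        · rw [hg_ne ζ hz, hζ', add_sub_cancel_left, smul_eq_mul, mul_div_assoc,
            mul_div_cancel₀ _ (pow_ne_zero _ hz)]
      refine ContinuousAt.congr ?_ hev.symm
      have := hg₀a.continuousAt
      exact ContinuousAt.comp (by simpa using this) hc
    · have hev : g =ᶠ[𝓝 ζ] fun z ↦ H (x₀ + z) / z ^ m := by
        filter_upwards [eventually_ne_nhds hζ] with z hz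
        exact hg_ne z hz
      refine ContinuousAt.congr ?_ hev.symm
      exact ((hd.continuous.continuousAt.comp (by fun_prop)).div (by fun_prop) (pow_ne_zero _ hζ))
  · by_cases hζ : ζ = 0
    · subst hζ
      have : m ≠ 0 := by omega
      simp [g, zero_pow this, h0]
    · rw [hg_ne ζ hζ, mul_div_cancel₀ _ (pow_ne_zero _ hζ)]

/-- A horizontal-strip bound for the factor `g`: `‖g(ζ)‖ ≤ M` whenever `|Im ζ| ≤ R` (`H_{t₀}` is
bounded on horizontal strips, and `g` is continuous on the unit disc). [folklore] -/
theorem exists_bound_factor {t₀ x₀ : ℝ} {m : ℕ} {g : ℂ → ℂ} (hgc : Continuous g)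
    (hfac : ∀ ζ : ℂ, deBruijnH t₀ (x₀ + ζ) = ζ ^ m * g ζ) (R : ℝ) :
    ∃ M : ℝ, 0 ≤ M ∧ ∀ ζ : ℂ, |ζ.im| ≤ R → ‖g ζ‖ ≤ M := by
  set B₁ : ℝ := ∫ u in Ioi (0 : ℝ), deBruijnHBound t₀ R u with hB₁
  have hstrip : ∀ z : ℂ, |z.im| ≤ R → ‖deBruijnH t₀ z‖ ≤ B₁ := by
    intro z hz
    rw [deBruijnH_eq_integral]
    exact norm_integral_le_of_norm_le (integrableOn_deBruijnHBound t₀ R)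
      (ae_restrict_of_forall_mem measurableSet_Ioi fun u hu ↦ norm_deBruijnHIntegrand_le le_rfl hz hu.le)
  obtain ⟨B₂, hB₂⟩ := (isCompact_closedBall (0 : ℂ) 1).exists_bound_of_continuousOn hgc.continuousOn
  refine ⟨max (max B₁ B₂) 0, le_max_right _ _, fun ζ hζ ↦ ?_⟩
  by_cases h1 : ‖ζ‖ ≤ 1
  · exact (hB₂ ζ (mem_closedBall_zero_iff.2 h1)).trans ((le_max_right _ _).trans (le_max_left _ _))
  · push Not at h1
    have hζ0 : ζ ≠ 0 := fun h ↦ by rw [h, norm_zero] at h1; exact absurd h1 (by norm_num)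
    have hg : g ζ = deBruijnH t₀ (x₀ + ζ) / ζ ^ m := by
      rw [hfac ζ, mul_div_cancel_left₀ _ (pow_ne_zero _ hζ0)]
    rw [hg, norm_div, norm_pow]
    have hpow : 1 ≤ ‖ζ‖ ^ m := one_le_pow₀ h1.le
    have hH : ‖deBruijnH t₀ (x₀ + ζ)‖ ≤ B₁ := hstrip _ (by simpa using hζ)
    calc ‖deBruijnH t₀ (↑x₀ + ζ)‖ / ‖ζ‖ ^ m ≤ ‖deBruijnH t₀ (↑x₀ + ζ)‖ :=
          div_le_self (norm_nonneg _) hpow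
      _ ≤ max (max B₁ B₂) 0 := hH.trans ((le_max_left _ _).trans (le_max_left _ _))


/-! ## Part C: the rescaled functions `σ^{-m} H_{t₀−σ²}(x₀ + σw)` and their uniform limit -/

section Rescaled

variable {t₀ x₀ : ℝ} {m : ℕ} {g : ℂ → ℂ}

/-- The Gaussian representation of the rescaled function:
`H_{t₀−σ²}(x₀ + σw) = (4π)^{-1/2} σ^m ∫ e^{−r²/4} (w + r)^m g(σ(w + r)) dr`. [folklore] -/
theorem deBruijnH_rescaled_eq (hfac : ∀ ζ : ℂ, deBruijnH t₀ (x₀ + ζ) = ζ ^ m * g ζ) (σ : ℝ)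
    (w : ℂ) :
    deBruijnH (t₀ - σ ^ 2) (x₀ + σ * w) = (((4 * Real.pi : ℝ) : ℂ) ^ (1 / 2 : ℂ))⁻¹ * (σ : ℂ) ^ m *
      ∫ r : ℝ, rescaledIntegrand g m (σ, w) r := by
  have e : (fun r : ℝ ↦ cexp (-(r : ℂ) ^ 2 / 4) * deBruijnH t₀ (x₀ + σ * w + σ * r)) =
      fun r : ℝ ↦ (σ : ℂ) ^ m * rescaledIntegrand g m (σ, w) r := by
    funext r
    dsimp only
    rw [show (x₀ : ℂ) + σ * w + σ * r = x₀ + σ * (w + r) by ring, hfac, mul_pow]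
    ring
  rw [deBruijnH_sub_sq_eq_integral, e, integral_const_mul, mul_assoc]

/-- At `σ = 0` the rescaled integral is `g(0) P_m(w)`. [folklore] -/
theorem integral_rescaledIntegrand_zero (g : ℂ → ℂ) (m : ℕ) (w : ℂ) :
    ∫ r : ℝ, rescaledIntegrand g m (0, w) r = g 0 * (heatPoly m).eval w := by
  rw [eval_heatPoly, ← integral_const_mul]
  congr 1
  funext r
  dsimp only
  simp only [Complex.ofReal_zero, zero_mul]
  ring

/-- Domination of the rescaled integrand for `|σ| ≤ 1`, `‖w‖ ≤ R`. [folklore] -/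
theorem norm_rescaledIntegrand_le {R M : ℝ} (hR : 0 ≤ R)
    (hM : ∀ ζ : ℂ, |ζ.im| ≤ R → ‖g ζ‖ ≤ M) {p : ℝ × ℂ} (hσ : |p.1| ≤ 1) (hw : ‖p.2‖ ≤ R) (r : ℝ) :
    ‖rescaledIntegrand g m p r‖ ≤
      M * 2 ^ m * (R ^ m * Real.exp (-(1 / 4) * r ^ 2) + |r| ^ m * Real.exp (-(1 / 4) * r ^ 2)) := by
  obtain ⟨σ, w⟩ := p
  dsimp only at hσ hw ⊢
  rw [norm_mul, norm_cexp_neg_sq_quarter, norm_mul, norm_pow]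
  have him : |((σ : ℂ) * (w + r)).im| ≤ R := by
    have e : ((σ : ℂ) * (w + r)).im = σ * w.im := by simp
    rw [e, abs_mul]
    calc |σ| * |w.im| ≤ 1 * R := by
          refine mul_le_mul hσ ((abs_im_le_norm w).trans hw) (abs_nonneg _) zero_le_one
      _ = R := one_mul R
  have hg := hM _ him
  have hwr : ‖w + r‖ ≤ R + |r| :=
    (norm_add_le _ _).trans (add_le_add hw (by rw [Complex.norm_real, Real.norm_eq_abs]))
  have hpow : ‖w + (r : ℂ)‖ ^ m ≤ 2 ^ m * (R ^ m + |r| ^ m) := by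
    have h2 : R + |r| ≤ 2 * max R |r| := by
      rw [two_mul]; exact add_le_add (le_max_left _ _) (le_max_right _ _)
    have hmax : (max R |r|) ^ m ≤ R ^ m + |r| ^ m := by
      rcases le_total R |r| with h | h
      · rw [max_eq_right h]; linarith [pow_nonneg hR m]
      · rw [max_eq_left h]; linarith [pow_nonneg (abs_nonneg r) m]
    calc ‖w + (r : ℂ)‖ ^ m ≤ (R + |r|) ^ m := pow_le_pow_left₀ (norm_nonneg _) hwr m
      _ ≤ (2 * max R |r|) ^ m := pow_le_pow_left₀ (by positivity) h2 m
      _ = 2 ^ m * (max R |r|) ^ m := mul_pow _ _ _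
      _ ≤ 2 ^ m * (R ^ m + |r| ^ m) := by gcongr
  have hexp : 0 ≤ Real.exp (-(1 / 4) * r ^ 2) := (Real.exp_pos _).le
  calc Real.exp (-(1 / 4) * r ^ 2) * (‖w + ↑r‖ ^ m * ‖g (↑σ * (w + ↑r))‖)
      ≤ Real.exp (-(1 / 4) * r ^ 2) * (2 ^ m * (R ^ m + |r| ^ m) * M) := by
        gcongr
    _ = M * 2 ^ m * (R ^ m * Real.exp (-(1 / 4) * r ^ 2) + |r| ^ m * Real.exp (-(1 / 4) * r ^ 2)) := by
        ring

/-- The dominating function is integrable. [folklore] -/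
theorem integrable_rescaled_bound (M R : ℝ) (m : ℕ) :
    Integrable fun r : ℝ ↦
      M * 2 ^ m * (R ^ m * Real.exp (-(1 / 4) * r ^ 2) + |r| ^ m * Real.exp (-(1 / 4) * r ^ 2)) := by
  refine Integrable.const_mul (Integrable.add ?_ ?_) _
  · exact (integrable_exp_neg_mul_sq (by norm_num : (0 : ℝ) < 1 / 4)).const_mul _
  · have := integrable_abs_rpow_mul_exp_neg_sq_quarter (p := m) (Nat.cast_nonneg m)
    refine this.congr (Eventually.of_forall fun r ↦ ?_)
    simp only [Real.rpow_natCast]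

/-- Joint continuity of `(σ, w) ↦ ∫ e^{−r²/4} (w + r)^m g(σ(w + r)) dr` on `[−1, 1] × B̄(0, R)`
(dominated convergence). [folklore] -/
theorem continuousOn_integral_rescaledIntegrand (hgc : Continuous g)
    (hfac : ∀ ζ : ℂ, deBruijnH t₀ (x₀ + ζ) = ζ ^ m * g ζ) {R : ℝ} (hR : 0 ≤ R) :
    ContinuousOn (fun p : ℝ × ℂ ↦ ∫ r : ℝ, rescaledIntegrand g m p r)
      (Icc (-1 : ℝ) 1 ×ˢ closedBall (0 : ℂ) R) := by
  obtain ⟨M, -, hM⟩ := exists_bound_factor hgc hfac R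
  refine continuousOn_of_dominated (bound := fun r : ℝ ↦
      M * 2 ^ m * (R ^ m * Real.exp (-(1 / 4) * r ^ 2) + |r| ^ m * Real.exp (-(1 / 4) * r ^ 2)))
    (fun p _ ↦ ?_) (fun p hp ↦ Eventually.of_forall fun r ↦ ?_) (integrable_rescaled_bound M R m)
    (Eventually.of_forall fun r ↦ ?_)
  · have : Continuous fun r : ℝ ↦ rescaledIntegrand g m p r := by
      fun_prop
    exact this.aestronglyMeasurable
  · rw [mem_prod, mem_Icc, mem_closedBall_zero_iff] at hp
    exact norm_rescaledIntegrand_le hR hM (abs_le.2 hp.1) hp.2 r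
  · have : Continuous fun p : ℝ × ℂ ↦ rescaledIntegrand g m p r := by
      fun_prop
    exact this.continuousOn

/-- Uniform convergence as `σ → 0`: for every `ε > 0` there is `δ > 0` such that
`‖∫ (σ, w) − ∫ (0, w)‖ < ε` for `|σ| < δ`, `|σ| ≤ 1`, uniformly in `‖w‖ ≤ R` (uniform continuity on
the compact set `[−1, 1] × B̄(0, R)`). [folklore] -/
theorem rescaled_uniform (hgc : Continuous g) (hfac : ∀ ζ : ℂ, deBruijnH t₀ (x₀ + ζ) = ζ ^ m * g ζ)
    {R : ℝ} (hR : 0 ≤ R) {ε : ℝ} (hε : 0 < ε) :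
    ∃ δ > 0, ∀ σ : ℝ, |σ| < δ → |σ| ≤ 1 → ∀ w ∈ closedBall (0 : ℂ) R,
      dist (∫ r : ℝ, rescaledIntegrand g m (σ, w) r) (∫ r : ℝ, rescaledIntegrand g m (0, w) r) < ε := by
  have hK : IsCompact (Icc (-1 : ℝ) 1 ×ˢ closedBall (0 : ℂ) R) :=
    isCompact_Icc.prod (isCompact_closedBall _ _)
  have huc := hK.uniformContinuousOn_of_continuous (continuousOn_integral_rescaledIntegrand hgc hfac hR)
  obtain ⟨δ, hδ, h⟩ := Metric.uniformContinuousOn_iff.1 huc ε hε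
  refine ⟨δ, hδ, fun σ hσδ hσ1 w hw ↦ h (σ, w) ⟨abs_le.1 hσ1 |> fun h ↦ ⟨h.1, h.2⟩, hw⟩ (0, w)
    ⟨⟨by norm_num, by norm_num⟩, hw⟩ ?_⟩
  rw [Prod.dist_eq, dist_self, Real.dist_eq, sub_zero]
  exact max_lt hσδ hδ

end Rescaled


/-! ## Part E: Hurwitz, and the Csordas–Smith–Varga theorem -/

/-- Zeros of a non-zero polynomial are isolated: around any point there are arbitrarily small
circles on which the polynomial does not vanish. [folklore] -/
theorem exists_sphere_eval_ne_zero {p : ℂ[X]} (hp : p ≠ 0) (w₀ : ℂ) {ρmax : ℝ} (hρmax : 0 < ρmax) :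
    ∃ ρ : ℝ, 0 < ρ ∧ ρ ≤ ρmax ∧ ∀ z ∈ sphere w₀ ρ, p.eval z ≠ 0 := by
  classical
  have hfin : {z : ℂ | p.IsRoot z ∧ z ≠ w₀}.Finite :=
    (p.finite_setOf_isRoot hp).subset fun z hz ↦ hz.1
  rcases hfin.toFinset.eq_empty_or_nonempty with h | h
  · refine ⟨ρmax, hρmax, le_rfl, fun z hz hz0 ↦ ?_⟩
    have hzw : z ≠ w₀ := by
      intro e
      rw [e, mem_sphere, dist_self] at hz
      linarith
    have : z ∈ hfin.toFinset := hfin.mem_toFinset.2 ⟨hz0, hzw⟩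
    rw [h] at this
    simp at this
  · obtain ⟨z₁, hz₁, hmin⟩ := hfin.toFinset.exists_min_image (fun z ↦ dist z w₀) h
    have hz₁' := hfin.mem_toFinset.1 hz₁
    have hd : 0 < dist z₁ w₀ := dist_pos.2 hz₁'.2
    refine ⟨min (dist z₁ w₀ / 2) ρmax, lt_min (by linarith) hρmax, min_le_right _ _,
      fun z hz hz0 ↦ ?_⟩
    rw [mem_sphere] at hz
    have hlt : 0 < min (dist z₁ w₀ / 2) ρmax := lt_min (by linarith) hρmax
    have hzw : z ≠ w₀ := by
      intro e
      rw [e, dist_self] at hz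
      linarith
    have hmem : z ∈ hfin.toFinset := hfin.mem_toFinset.2 ⟨hz0, hzw⟩
    have := hmin z hmem
    linarith [min_le_left (dist z₁ w₀ / 2) ρmax]

section Rescaled

variable {t₀ x₀ : ℝ} {m : ℕ} {g : ℂ → ℂ}

/-- **The heart of the Csordas–Smith–Varga argument.** If `H_{t₀}(x₀ + ζ) = ζ^m g(ζ)` with
`m ≥ 2`, `g` continuous, `g(0) ≠ 0`, then for all small `σ > 0` the function `H_{t₀ − σ²}` has a
non-real zero (near `x₀ + σ w*`, `w*` a non-real root of the heat polynomial `P_m`): the rescaled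
functions `σ^{−m} H_{t₀−σ²}(x₀ + σ w)` converge uniformly near `w*` to `(4π)^{-1/2} g(0) P_m(w)`,
and Hurwitz's theorem applies. [cite: AndradeChangMiller2014, Remark 1.6] -/
theorem eventually_exists_nonreal_zero (hm : 2 ≤ m) (hgc : Continuous g) (hg0 : g 0 ≠ 0)
    (hfac : ∀ ζ : ℂ, deBruijnH t₀ (x₀ + ζ) = ζ ^ m * g ζ) :
    ∀ᶠ σ : ℝ in 𝓝[>] 0, ∃ z : ℂ, deBruijnH (t₀ - σ ^ 2) z = 0 ∧ z.im ≠ 0 := by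
  obtain ⟨wstar, hroot, hwim⟩ := exists_root_heatPoly_im_ne_zero hm
  set Cst : ℂ := ((4 * Real.pi : ℝ) : ℂ) ^ (1 / 2 : ℂ) with hCst
  have hC0 : Cst ≠ 0 := four_pi_cpow_half_ne_zero
  -- the family and its limit
  set F : ℝ → ℂ → ℂ := fun σ w ↦ Cst * ((σ : ℂ) ^ m)⁻¹ * deBruijnH (t₀ - σ ^ 2) (x₀ + σ * w)
    with hF
  set f : ℂ → ℂ := fun w ↦ g 0 * (heatPoly m).eval w with hf
  have hFΨ : ∀ σ : ℝ, σ ≠ 0 → ∀ w, F σ w = ∫ r : ℝ, rescaledIntegrand g m (σ, w) r := by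
    intro σ hσ w
    set Int : ℂ := ∫ r : ℝ, rescaledIntegrand g m (σ, w) r with hInt
    simp only [hF]
    rw [deBruijnH_rescaled_eq hfac, ← hInt, ← hCst]
    have : (σ : ℂ) ^ m ≠ 0 := pow_ne_zero _ (Complex.ofReal_ne_zero.2 hσ)
    field_simp
  have hfΨ : ∀ w, f w = ∫ r : ℝ, rescaledIntegrand g m (0, w) r := fun w ↦
    (integral_rescaledIntegrand_zero g m w).symm
  -- a small circle around `w*` free of roots, inside `{Im ≠ 0}`
  have hp0 : heatPoly m ≠ 0 := by
    intro h
    have := (natDegree_heatPoly m).2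
    rw [h, leadingCoeff_zero] at this
    exact hC0 this.symm
  have him0 : 0 < |wstar.im| := abs_pos.2 hwim
  obtain ⟨ρ, hρ, hρle, hsphere⟩ := exists_sphere_eval_ne_zero hp0 wstar
    (ρmax := min 1 (|wstar.im| / 2)) (lt_min one_pos (by linarith))
  -- the compact parameter box for the uniform estimate
  set R : ℝ := ‖wstar‖ + 1 with hR
  have hsub : closedBall wstar ρ ⊆ closedBall (0 : ℂ) R := by
    intro w hw
    rw [mem_closedBall_zero_iff]
    rw [mem_closedBall, dist_eq_norm] at hw
    calc ‖w‖ = ‖(w - wstar) + wstar‖ := by rw [sub_add_cancel]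
      _ ≤ ‖w - wstar‖ + ‖wstar‖ := norm_add_le _ _
      _ ≤ R := by rw [hR]; linarith [hρle.trans (min_le_left _ _)]
  -- uniform convergence on the closed disc along `σ → 0⁺`
  have hunif : TendstoUniformlyOn F f (𝓝[>] (0 : ℝ)) (closedBall wstar ρ) := by
    rw [Metric.tendstoUniformlyOn_iff]
    intro ε hε
    obtain ⟨δ, hδ, hδε⟩ := rescaled_uniform hgc hfac (R := R) (by positivity) hε
    have h1 : ∀ᶠ σ : ℝ in 𝓝[>] 0, σ ∈ Ioo 0 (min δ 1) := Ioo_mem_nhdsGT (lt_min hδ one_pos)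
    filter_upwards [h1] with σ hσ w hw
    obtain ⟨hσ0, hσ1⟩ := hσ
    rw [hfΨ, hFΨ σ hσ0.ne' w, dist_comm]
    exact hδε σ (by rw [abs_of_pos hσ0]; exact hσ1.trans_le (min_le_left _ _))
      (by rw [abs_of_pos hσ0]; exact (hσ1.trans_le (min_le_right _ _)).le) w (hsub hw)
  -- Hurwitz
  have hFd : ∀ᶠ σ : ℝ in 𝓝[>] 0, DiffContOnCl ℂ (F σ) (ball wstar ρ) :=
    Eventually.of_forall fun σ ↦ by
      have : Differentiable ℂ (F σ) := by
        simp only [hF]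
        have hd := differentiable_deBruijnH_holds (t₀ - σ ^ 2)
        exact (hd.comp (by fun_prop)).const_mul _
      exact this.diffContOnCl
  have hfc : ContinuousOn f (sphere wstar ρ) := by
    have : Continuous f := by simp only [hf]; exact continuous_const.mul (Polynomial.continuous _)
    exact this.continuousOn
  have hf0 : f wstar = 0 := by
    simp only [hf]
    exact mul_eq_zero_of_right _ hroot.eq_zero
  have hsph : ∀ z ∈ sphere wstar ρ, f z ≠ 0 := fun z hz ↦ mul_ne_zero hg0 (hsphere z hz)
  have hz := Complex.eventually_exists_zero_mem_ball_of_tendstoUniformlyOn hρ hFd hunif hfc hf0 hsph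
  have hpos : ∀ᶠ σ : ℝ in 𝓝[>] 0, 0 < σ := eventually_mem_nhdsWithin
  filter_upwards [hz, hpos] with σ ⟨w, hw, hFw⟩ hσ
  refine ⟨x₀ + σ * w, ?_, ?_⟩
  · simp only [hF] at hFw
    have h1 : Cst * ((σ : ℂ) ^ m)⁻¹ ≠ 0 :=
      mul_ne_zero hC0 (inv_ne_zero (pow_ne_zero _ (Complex.ofReal_ne_zero.2 hσ.ne')))
    exact (mul_eq_zero.1 hFw).resolve_left h1
  · have hwim' : w.im ≠ 0 := by
      intro h0
      rw [mem_ball, dist_eq_norm] at hw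
      have h2 : |(w - wstar).im| ≤ ‖w - wstar‖ := abs_im_le_norm _
      rw [Complex.sub_im, h0, zero_sub, abs_neg] at h2
      have hρ' : ρ ≤ |wstar.im| / 2 := hρle.trans (min_le_right _ _)
      linarith
    rw [Complex.add_im, Complex.ofReal_im, zero_add, Complex.mul_im, Complex.ofReal_re,
      Complex.ofReal_im, zero_mul, add_zero]
    exact mul_ne_zero hσ.ne' hwim'

end Rescaled

/-- **Discharge of `Literature.NumberTheory.LFunctions.csordasSmithVarga_simple_zeros`** (Csordas–Smith–Varga 1994, Thm. 2.2:
"if `H_{t₀}` has a zero `x₀` of order at least `2`, then `t₀ ≤ Λ`"; here in the `sInf`-free form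
of `DeBruijnHSimpleZeros.lean`). Proof: by `eventually_exists_nonreal_zero`, `H_{t₀ − σ²}` has a
non-real zero for all small `σ > 0`, while de Bruijn's monotonicity (`mono_deBruijnH_holds`)
propagates the real-rootedness of `H_{t₁}`, `t₁ < t₀`, to every `H_t`, `t ≥ t₁`.
[cite: CsordasSmithVarga1994, Thm. 2.2] -/
theorem csordasSmithVarga_simple_zeros_holds : csordasSmithVarga_simple_zeros := by
  intro t₁ t₀ hlt hreal x₀ hx₀ hderiv
  obtain ⟨m, g, hm, hgc, hg0, hfac⟩ := exists_factor_of_multiple_zero t₀ hx₀ hderiv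
  have key := eventually_exists_nonreal_zero hm hgc hg0 hfac
  have hsmall : ∀ᶠ σ : ℝ in 𝓝[>] 0, σ ^ 2 < t₀ - t₁ := by
    have hc : ContinuousAt (fun σ : ℝ ↦ σ ^ 2) 0 := by fun_prop
    have : ∀ᶠ σ : ℝ in 𝓝 0, σ ^ 2 < t₀ - t₁ :=
      hc.eventually_lt continuousAt_const (by simpa using sub_pos.2 hlt)
    exact this.filter_mono nhdsWithin_le_nhds
  obtain ⟨σ, ⟨z, hz, hzim⟩, hσ2⟩ := (key.and hsmall).exists
  have hreal' : HasOnlyRealZeros (deBruijnH (t₀ - σ ^ 2)) :=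
    mono_deBruijnH_holds (by linarith) hreal
  exact hzim (hreal' z hz)

end Literature.NumberTheory.LFunctions

end
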